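import Literature.Analysis.FluidPDE.HessianLaplacianLpProofs
import Literature.Analysis.FluidPDE.CKNPressureDuality
import Literature.Analysis.FluidPDE.CKNInterpolationEstimate
import Literature.Analysis.FunctionSpaces.WeakNormSq
import Literature.Analysis.FunctionSpaces.SobolevBallScaling
import HarnessLib

/-!
# The Calderón–Zygmund part of the local pressure on a time slice (towards (13.29))

Analysis/FluidPDE support file (all results proved) in the decomposition of the named fact
`Literature.Analysis.FluidPDE.LemarieRieusset2016.step1_pressureTerm`
(`CKNMorreyLocalEnergySteps.lean`; Lemarié-Rieusset 2016, (13.28)–(13.29), p. 469: the pressure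
term of the local energy inequality in the proof of Lemma 13.3).

In print the local pressure `ζp` is split through the Newtonian kernel `G`, and its
Calderón–Zygmund part `q_{ρ,x} = ∑ⱼₗ ∂ⱼ∂ₗG * (ζ(uⱼuₗ - Γ_{ρ,u,j,l})) + …` is bounded slice-wise by
"`‖q_{ρ,x}(s,·)‖_{L^{3/2}} ≤ C ‖u(s)‖_{L²(B(x,ρ))} ‖∇ ⊗ u(s)‖_{L²(B(x,ρ))}`" (Calderón–Zygmund and
the Gagliardo–Nirenberg inequality, p. 469). Here, as in the tree's treatment of (13.20)
(`CKNPressureDuality`), the kernel is moved onto the test function: for a spatial test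
function `ψ` let `Ψ = N_{r/2,r}[ψ]` be its truncated Newtonian potential, supported in the ball
`B = B(x, ρ)` on which the slice `w = u(s,·)` has the weak gradient `Gw = ∇ ⊗ u(s,·)`. Then

  `‖∫ D²Ψ(w, w)‖ ≤ K ‖w‖_{L²(B)} ‖Gw‖_{L²(B)} ‖ψ‖_{L³}`     (`exists_hessian_slice_bound`),

the dual form of the printed bound, with an absolute `K`. Proof (the printed one, dualised):
`D²Ψ(w,w) = ∑ᵢⱼ wᵢwⱼ ∂ⱼ∂ᵢΨ`; since `∫ ∂ⱼ∂ᵢΨ = 0` one may subtract constants,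
`∫ wᵢwⱼ ∂ⱼ∂ᵢΨ = ∫_B (wᵢwⱼ - cᵢⱼ) ∂ⱼ∂ᵢΨ`; Hölder with exponents `(3/2, 3)`; the `L³` bound for the
Hessian of `N` (Stein 1970, III §1.3 Prop. 3, PROVED in the tree:
`stein1970_hessian_Lp_bound_holds_fin3`); and, writing `wᵢwⱼ = ¼(⟪w,eᵢ+eⱼ⟫² - ⟪w,eᵢ-eⱼ⟫²)`,
the Poincaré–Sobolev inequality on balls `‖f² - ⨍_B f²‖_{L^{3/2}(B)} ≤ C_P ‖∇f²‖_{L¹(B)}`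
(`exists_eLpNorm_sub_average_le_ball`, scale-invariant) with the product rule
`∇f² = 2f∇f ∈ L¹` for `f = ⟪w, a⟫ ∈ W^{1,2}(B)` (`HasWeakFDerivOn.norm_sq`).

* `HasWeakFDerivOn.clm_comp` — weak derivatives commute with continuous linear maps on the
  range (`∂(L ∘ f) = L ∘ ∂f`);
* `eLpNorm_inner_sq_sub_average_le` — `‖⟪a,w⟫² - ⨍_B ⟪a,w⟫²‖_{L^{3/2}(B)} ≤ 8 C_P ‖w‖_{L²} ‖Gw‖_{L²}`
  for `‖a‖ ≤ 2`;
* `exists_hessian_slice_bound` — the displayed estimate.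

## References

* P. G. Lemarié-Rieusset, *The Navier–Stokes Problem in the 21st Century*, CRC Press (2016),
  §13.9 Step 1, p. 469. [LemarieRieusset2016]
* E. M. Stein, *Singular integrals and differentiability properties of functions* (1970),
  Ch. III §1.3, Prop. 3. [Stein1971]
-/

noncomputable section

open MeasureTheory Set Function Filter Topology TopologicalSpace Metric InnerProductSpace
open scoped ENNReal NNReal RealInnerProductSpace

/-! ### Weak derivatives and continuous linear maps on the range -/

namespace Literature.Analysis.FunctionSpaces

variable {E' : Type*} [NormedAddCommGroup E'] [NormedSpace ℝ E'] [MeasurableSpace E']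
  [BorelSpace E']
variable {F : Type*} [NormedAddCommGroup F] [NormedSpace ℝ F] [CompleteSpace F]
variable {F' : Type*} [NormedAddCommGroup F'] [NormedSpace ℝ F'] [CompleteSpace F']

/-- **Weak derivatives commute with continuous linear maps on the range**: if `g` is a weak
derivative of `f` on `Ω`, then `x ↦ L ∘ g(x)` is a weak derivative of `L ∘ f` (apply `L` to the
defining identity; Evans, *PDE*, §5.2.3 Thm. 1, linearity). [folklore] -/
theorem HasWeakFDerivOn.clm_comp {Ω : Opens E'} {μ : Measure E'} {f : E' → F}
    {g : E' → E' →L[ℝ] F} (h : HasWeakFDerivOn Ω μ f g) (L : F →L[ℝ] F') :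
    HasWeakFDerivOn Ω μ (fun x => L (f x)) (fun x => L.comp (g x)) := by
  refine ⟨L.locallyIntegrableOn_comp h.locallyIntegrableOn,
    (ContinuousLinearMap.compL ℝ E' F F' L).locallyIntegrableOn_comp h.locallyIntegrableOn_deriv,
    fun φ v hφ => ?_⟩
  -- integrability on `Ω` of `c • f` for `f` locally integrable and `c` continuous, compactly
  -- supported in `Ω`
  have hint : ∀ {G : Type _} [NormedAddCommGroup G] [NormedSpace ℝ G] {f : E' → G},
      LocallyIntegrableOn f (Ω : Set E') μ → ∀ {c : E' → ℝ}, Continuous c →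
      HasCompactSupport c → tsupport c ⊆ (Ω : Set E') →
      IntegrableOn (fun x => c x • f x) (Ω : Set E') μ := by
    intro G _ _ f hf c hc hcs hcΩ
    have hK : IntegrableOn (fun x => c x • f x) (tsupport c) μ :=
      (hf.integrableOn_compact_subset hcΩ hcs).continuousOn_smul hc.continuousOn hcs
    refine hK.of_forall_sdiff_eq_zero Ω.isOpen.measurableSet fun x hx => ?_
    rw [image_eq_zero_of_notMem_tsupport hx.2, zero_smul]
  have hφ'c : Continuous fun x => fderiv ℝ φ x v :=
    (hφ.contDiff.continuous_fderiv (by simp)).clm_apply continuous_const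
  have hφ's : HasCompactSupport fun x => fderiv ℝ φ x v :=
    hφ.hasCompactSupport.fderiv_apply (𝕜 := ℝ) v
  have hφ'Ω : tsupport (fun x => fderiv ℝ φ x v) ⊆ (Ω : Set E') :=
    (tsupport_fderiv_apply_subset ℝ v).trans hφ.tsupport_subset
  have I₁ := hint h.locallyIntegrableOn hφ'c hφ's hφ'Ω
  have J₁ := hint ((ContinuousLinearMap.apply ℝ F v).locallyIntegrableOn_comp
    h.locallyIntegrableOn_deriv) hφ.contDiff.continuous hφ.hasCompactSupport hφ.tsupport_subset
  simp only [Function.comp_def, ContinuousLinearMap.apply_apply] at J₁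
  have e1 : (fun x => fderiv ℝ φ x v • L (f x)) = fun x => L (fderiv ℝ φ x v • f x) := by
    funext x; rw [L.map_smul]
  have e2 : (fun x => φ x • (L.comp (g x)) v) = fun x => L (φ x • g x v) := by
    funext x; rw [L.map_smul]; rfl
  rw [e1, e2, L.integral_comp_comm I₁, L.integral_comp_comm J₁, h.integral_fderiv_smul_eq φ v hφ,
    L.map_neg]

end Literature.Analysis.FunctionSpaces

namespace Literature.Analysis.FluidPDE

/-! ### The components `⟪a, w⟫` of a `W^{1,2}` field and their squares -/

section Components

variable {x₀ : EuclideanSpace ℝ (Fin 3)} {ρ : ℝ}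
  {w : EuclideanSpace ℝ (Fin 3) → EuclideanSpace ℝ (Fin 3)}
  {Gw : EuclideanSpace ℝ (Fin 3) → EuclideanSpace ℝ (Fin 3) →L[ℝ] EuclideanSpace ℝ (Fin 3)}

/-- For `w ∈ W^{1,2}(B)` with weak gradient `Gw` and a fixed vector `a`, the component
`f = ⟪a, w⟫` is in `W^{1,2}(B)` with weak derivative `v ↦ ⟪a, Gw v⟫`, and
`‖f‖_{L²} ≤ ‖a‖ ‖w‖_{L²}`, `‖∇f‖_{L²} ≤ ‖a‖ ‖Gw‖_{L²}`. [folklore] -/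
theorem inner_component_sobolev
    (hw : FunctionSpaces.HasWeakFDerivOn
      (⟨ball x₀ ρ, isOpen_ball⟩ : Opens (EuclideanSpace ℝ (Fin 3))) volume w Gw)
    (hwL2 : MemLp w 2 (volume.restrict (ball x₀ ρ)))
    (hGL2 : MemLp Gw 2 (volume.restrict (ball x₀ ρ))) (a : EuclideanSpace ℝ (Fin 3)) :
    FunctionSpaces.MemSobolevDomain 1 2
        (⟨ball x₀ ρ, isOpen_ball⟩ : Opens (EuclideanSpace ℝ (Fin 3))) volume
        (fun y => innerSL ℝ a (w y)) ∧
      FunctionSpaces.HasWeakFDerivOn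
        (⟨ball x₀ ρ, isOpen_ball⟩ : Opens (EuclideanSpace ℝ (Fin 3))) volume
        (fun y => innerSL ℝ a (w y)) (fun y => (innerSL ℝ a).comp (Gw y)) ∧
      MemLp (fun y => innerSL ℝ a (w y)) 2 (volume.restrict (ball x₀ ρ)) ∧
      MemLp (fun y => (innerSL ℝ a).comp (Gw y)) 2 (volume.restrict (ball x₀ ρ)) ∧
      eLpNorm (fun y => innerSL ℝ a (w y)) 2 (volume.restrict (ball x₀ ρ)) ≤
        ENNReal.ofReal ‖a‖ * eLpNorm w 2 (volume.restrict (ball x₀ ρ)) ∧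
      eLpNorm (fun y => (innerSL ℝ a).comp (Gw y)) 2 (volume.restrict (ball x₀ ρ)) ≤
        ENNReal.ofReal ‖a‖ * eLpNorm Gw 2 (volume.restrict (ball x₀ ρ)) := by
  have hD := hw.clm_comp (innerSL ℝ a)
  have hfL : MemLp (fun y => innerSL ℝ a (w y)) 2 (volume.restrict (ball x₀ ρ)) :=
    (innerSL ℝ a).comp_memLp' hwL2
  have hgL : MemLp (fun y => (innerSL ℝ a).comp (Gw y)) 2 (volume.restrict (ball x₀ ρ)) :=
    (ContinuousLinearMap.compL ℝ (EuclideanSpace ℝ (Fin 3)) (EuclideanSpace ℝ (Fin 3)) ℝ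
      (innerSL ℝ a)).comp_memLp' hGL2
  have hsob : FunctionSpaces.MemSobolevDomain 1 2
      (⟨ball x₀ ρ, isOpen_ball⟩ : Opens (EuclideanSpace ℝ (Fin 3))) volume
      (fun y => innerSL ℝ a (w y)) := by
    refine FunctionSpaces.memSobolevDomain_succ_iff.2 ⟨hfL, _, hD, fun v => ?_⟩
    rw [FunctionSpaces.memSobolevDomain_zero_iff]
    exact (ContinuousLinearMap.apply ℝ ℝ v).comp_memLp' hgL
  refine ⟨hsob, hD, hfL, hgL, ?_, ?_⟩
  · refine eLpNorm_le_mul_eLpNorm_of_ae_le_mul (Eventually.of_forall fun y => ?_) 2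
    calc ‖innerSL ℝ a (w y)‖ ≤ ‖innerSL ℝ a‖ * ‖w y‖ := (innerSL ℝ a).le_opNorm _
      _ = ‖a‖ * ‖w y‖ := by rw [innerSL_apply_norm]
  · refine eLpNorm_le_mul_eLpNorm_of_ae_le_mul (Eventually.of_forall fun y => ?_) 2
    calc ‖(innerSL ℝ a).comp (Gw y)‖ ≤ ‖innerSL ℝ a‖ * ‖Gw y‖ :=
          ContinuousLinearMap.opNorm_comp_le _ _
      _ = ‖a‖ * ‖Gw y‖ := by rw [innerSL_apply_norm]

/-- **`‖⟪a,w⟫² - ⨍_B ⟪a,w⟫²‖_{L^{3/2}(B)} ≤ C_P · 2‖a‖² ‖w‖_{L²(B)} ‖Gw‖_{L²(B)}`** on a ball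
`B = B(x₀, ρ)` of `ℝ³`, for `w ∈ W^{1,2}(B)` with weak gradient `Gw`: the Poincaré–Sobolev
inequality on balls with constant `C_P` (`exists_eLpNorm_sub_average_le_ball`, `p = 1`,
`p' = 3/2`, the "Gagliardo–Nirenberg inequality" of Lemarié-Rieusset 2016, p. 468–469) applied
to `f² ∈ W^{1,1}(B)`, `f = ⟪a, w⟫`, whose weak gradient `2f∇f` has
`‖2f∇f‖_{L¹} ≤ 2‖f‖_{L²}‖∇f‖_{L²} ≤ 2‖a‖²‖w‖_{L²}‖Gw‖_{L²}`. [cite: LemarieRieusset2016, §13.9 p. 469] -/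
theorem eLpNorm_inner_sq_sub_average_le {CP : ℝ≥0}
    (hCP : ∀ (x₀ : EuclideanSpace ℝ (Fin 3)) (r : ℝ), 0 < r → ∀ (f : EuclideanSpace ℝ (Fin 3) → ℝ)
      (g : EuclideanSpace ℝ (Fin 3) → EuclideanSpace ℝ (Fin 3) →L[ℝ] ℝ),
      FunctionSpaces.MemSobolevDomain 1 ((1 : ℝ≥0) : ℝ≥0∞)
        (⟨ball x₀ r, isOpen_ball⟩ : Opens (EuclideanSpace ℝ (Fin 3))) volume f →
      FunctionSpaces.HasWeakFDerivOn
        (⟨ball x₀ r, isOpen_ball⟩ : Opens (EuclideanSpace ℝ (Fin 3))) volume f g →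
      eLpNorm (fun x => f x - ⨍ y in ball x₀ r, f y) ((3 / 2 : ℝ≥0) : ℝ≥0∞)
          (volume.restrict (ball x₀ r)) ≤
        CP * eLpNorm g ((1 : ℝ≥0) : ℝ≥0∞) (volume.restrict (ball x₀ r)))
    (hρ : 0 < ρ)
    (hw : FunctionSpaces.HasWeakFDerivOn
      (⟨ball x₀ ρ, isOpen_ball⟩ : Opens (EuclideanSpace ℝ (Fin 3))) volume w Gw)
    (hwL2 : MemLp w 2 (volume.restrict (ball x₀ ρ)))
    (hGL2 : MemLp Gw 2 (volume.restrict (ball x₀ ρ))) (a : EuclideanSpace ℝ (Fin 3)) :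
    eLpNorm (fun y => (innerSL ℝ a (w y)) ^ 2 - ⨍ z in ball x₀ ρ, (innerSL ℝ a (w z)) ^ 2)
        ((3 / 2 : ℝ≥0) : ℝ≥0∞) (volume.restrict (ball x₀ ρ)) ≤
      CP * (2 * (ENNReal.ofReal ‖a‖ * eLpNorm w 2 (volume.restrict (ball x₀ ρ))) *
        (ENNReal.ofReal ‖a‖ * eLpNorm Gw 2 (volume.restrict (ball x₀ ρ)))) := by
  obtain ⟨hsob, hD, hfL, hgL, hf2, hg2⟩ := inner_component_sobolev hw hwL2 hGL2 a
  set B : Opens (EuclideanSpace ℝ (Fin 3)) := ⟨ball x₀ ρ, isOpen_ball⟩ with hB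
  set f : EuclideanSpace ℝ (Fin 3) → ℝ := fun y => innerSL ℝ a (w y) with hf
  have hLip := FunctionSpaces.isLipschitzDomain_ball x₀ ρ
  -- `f² ∈ W^{1,1}(B)` with `∇f² = 2 f ∇f`
  have hD2 := FunctionSpaces.HasWeakFDerivOn.norm_sq hLip isBounded_ball hsob hD
  have hW2 := FunctionSpaces.memSobolevDomain_one_one_norm_sq hLip isBounded_ball hsob hD
  have hsq : (fun y => ‖f y‖ ^ 2) = fun y => (f y) ^ 2 := by
    funext y; rw [Real.norm_eq_abs, sq_abs]
  rw [hsq] at hD2 hW2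
  have hW2' : FunctionSpaces.MemSobolevDomain 1 ((1 : ℝ≥0) : ℝ≥0∞) B volume fun y => (f y) ^ 2 := by
    rw [ENNReal.coe_one]; exact hW2
  have key := hCP x₀ ρ hρ _ _ hW2' hD2
  rw [ENNReal.coe_one] at key
  refine key.trans ?_
  gcongr
  -- `‖2 f ∇f‖_{L¹} ≤ 2 ‖f‖_{L²} ‖∇f‖_{L²}`
  refine (FunctionSpaces.eLpNorm_two_smul_innerSL_comp_le hfL.1 hgL.1).trans ?_
  gcongr

end Components

/-! ### Second derivatives off the support -/

/-- Coordinate second derivatives of a function vanish off its topological support. [folklore] -/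
theorem fderiv_fderiv_apply_eq_zero_of_notMem_tsupport {E : Type*} [NormedAddCommGroup E]
    [NormedSpace ℝ E] {g : E → ℝ} {x : E} (hx : x ∉ tsupport g) (c d : E) :
    fderiv ℝ (fun y => fderiv ℝ g y c) x d = 0 := by
  have h1 : g =ᶠ[𝓝 x] fun _ => (0 : ℝ) := notMem_tsupport_iff_eventuallyEq.1 hx
  have h2 : (fun y => fderiv ℝ g y c) =ᶠ[𝓝 x] fun _ => (0 : ℝ) := by
    filter_upwards [eventually_eventuallyEq_nhds.2 h1] with y hy
    rw [hy.fderiv_eq, fderiv_fun_const, Pi.zero_apply, _root_.zero_apply]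
  rw [h2.fderiv_eq, fderiv_fun_const, Pi.zero_apply, _root_.zero_apply]

/-! ### The Hessian of the truncated potential against `w ⊗ w` on a slice -/

/-- **The Calderón–Zygmund part of the local pressure, one time slice, dual form**
(Lemarié-Rieusset 2016, p. 469: "`‖q_{ρ,x}‖_{L^{3/2}} ≤ C ‖u‖_{L⁶_tL²_x(Q_ρ)} ‖∇ ⊗ u‖_{L²_tL²_x(Q_ρ)}`"
by Calderón–Zygmund for `∂ⱼ∂ₗG *`, the maximal function and the Gagliardo–Nirenberg
inequality, slice by slice). There is an absolute constant `K` such that: for every ball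
`B = B(x₀, ρ)` of `ℝ³`, every field `w` with a weak gradient `Gw` on `B` and
`∫_B |w|², ∫_B |Gw|² < ∞`, every `ψ ∈ C²_c(ℝ³)` and every scale `r > 0` such that the truncated
Newtonian potential `Ψ = N_{r/2,r}[ψ]` is supported in `B`,
`‖∫ D²Ψ(y)(w(y), w(y)) dy‖ ≤ K (∫_B |w|²)^{1/2} (∫_B |Gw|²)^{1/2} ‖ψ‖_{L³(ℝ³)}`.
Proof: `D²Ψ(w,w) = ∑ᵢⱼ wᵢwⱼ ∂ⱼ∂ᵢΨ` and `∫ ∂ⱼ∂ᵢΨ = 0`, so constants may be subtracted from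
`wᵢwⱼ = ¼(⟪w,eᵢ+eⱼ⟫² - ⟪w,eᵢ-eⱼ⟫²)`; Hölder `(3/2, 3)`, Stein's `L³` bound for `∂ⱼ∂ᵢN`
(`stein1970_hessian_Lp_bound_holds_fin3`), and `eLpNorm_inner_sq_sub_average_le`. [cite: LemarieRieusset2016, §13.9 p. 469] -/
theorem exists_hessian_slice_bound :
    ∃ K : ℝ≥0, ∀ (x₀ : EuclideanSpace ℝ (Fin 3)) (ρ : ℝ), 0 < ρ →
      ∀ (w : EuclideanSpace ℝ (Fin 3) → EuclideanSpace ℝ (Fin 3))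
      (Gw : EuclideanSpace ℝ (Fin 3) → EuclideanSpace ℝ (Fin 3) →L[ℝ] EuclideanSpace ℝ (Fin 3)),
      FunctionSpaces.HasWeakFDerivOn
        (⟨ball x₀ ρ, isOpen_ball⟩ : Opens (EuclideanSpace ℝ (Fin 3))) volume w Gw →
      (∫⁻ y in ball x₀ ρ, ‖w y‖ₑ ^ 2) ≠ ∞ →
      (∫⁻ y in ball x₀ ρ, ENNReal.ofReal (frobeniusNormSq (Gw y))) ≠ ∞ →
      ∀ (ψ : EuclideanSpace ℝ (Fin 3) → ℝ), ContDiff ℝ 2 ψ → HasCompactSupport ψ →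
      ∀ (r : ℝ), 0 < r →
        tsupport (newtonNearPotential (r / 2) r ψ) ⊆ ball x₀ ρ →
        ‖∫ y, fderiv ℝ (fderiv ℝ (newtonNearPotential (r / 2) r ψ)) y (w y) (w y)‖ₑ ≤
          K * (∫⁻ y in ball x₀ ρ, ‖w y‖ₑ ^ 2) ^ (1 / 2 : ℝ) *
            (∫⁻ y in ball x₀ ρ, ENNReal.ofReal (frobeniusNormSq (Gw y))) ^ (1 / 2 : ℝ) *
            eLpNorm ψ 3 volume := by
  -- the two constants: Stein at `p = 3`, Poincaré–Sobolev at `(1, 3/2)`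
  obtain ⟨C₃, hC₃⟩ := stein1970_hessian_Lp_bound_holds_fin3.hessian_newtonNearPotential_half
    (p := 3) (by norm_num) (by norm_num)
  obtain ⟨CP, hCP⟩ := FunctionSpaces.exists_eLpNorm_sub_average_le_ball
    (E := EuclideanSpace ℝ (Fin 3)) (F := ℝ)
    (p := 1) (p' := 3 / 2) le_rfl (by rw [finrank_euclideanSpace_fin]; norm_num)
    (by rw [finrank_euclideanSpace_fin]; push_cast; norm_num)
  refine ⟨9 * (4 * CP * C₃), fun x₀ ρ hρ w Gw hw ha he ψ hψ hψc r hr hsupp => ?_⟩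
  have h₀ : 0 < r / 2 := by positivity
  have h₁ : r / 2 < r := by linarith
  set B : Set (EuclideanSpace ℝ (Fin 3)) := ball x₀ ρ with hBdef
  set ν : Measure (EuclideanSpace ℝ (Fin 3)) := volume.restrict B with hν
  set Ψ : EuclideanSpace ℝ (Fin 3) → ℝ := newtonNearPotential (r / 2) r ψ with hΨdef
  have hΨ2 : ContDiff ℝ 2 Ψ := contDiff_newtonNearPotential h₀.le h₁ 2 hψ
  have hΨc : HasCompactSupport Ψ := hasCompactSupport_newtonNearPotential h₀.le h₁ hψc
  -- the slice quantities and the `L²` classes of `w`, `Gw`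
  set A : ℝ≥0∞ := ∫⁻ y in B, ‖w y‖ₑ ^ 2 with hA
  set EE : ℝ≥0∞ := ∫⁻ y in B, ENNReal.ofReal (frobeniusNormSq (Gw y)) with hEE
  have hwm : AEStronglyMeasurable w ν := hw.locallyIntegrableOn.aestronglyMeasurable
  have hGm : AEStronglyMeasurable Gw ν := hw.locallyIntegrableOn_deriv.aestronglyMeasurable
  have hL2 : eLpNorm w 2 ν = A ^ (1 / 2 : ℝ) := by
    rw [eLpNorm_eq_lintegral_rpow_enorm_toReal two_ne_zero ENNReal.ofNat_ne_top,
      ENNReal.toReal_ofNat, hA]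
    simp only [one_div]
    congr 1
    refine lintegral_congr fun y => ?_
    rw [show (2 : ℝ) = ((2 : ℕ) : ℝ) by norm_num, ENNReal.rpow_natCast]
  have hG2 : eLpNorm Gw 2 ν ≤ EE ^ (1 / 2 : ℝ) := eLpNorm_two_le_lintegral_frobeniusNormSq_rpow ν Gw
  have hwL2 : MemLp w 2 ν :=
    ⟨hwm, by rw [hL2]; exact ENNReal.rpow_lt_top_of_nonneg (by norm_num) ha⟩
  have hGL2 : MemLp Gw 2 ν :=
    ⟨hGm, hG2.trans_lt (ENNReal.rpow_lt_top_of_nonneg (by norm_num) he)⟩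
  -- `|w|² ∈ L¹(B)`
  have hw2int : IntegrableOn (fun y => ‖w y‖ ^ 2) B volume :=
    (memLp_two_iff_integrable_sq_norm hwm).1 hwL2
  -- coordinates and the Hessian entries
  set e := EuclideanSpace.basisFun (Fin 3) ℝ with he_def
  set H : Fin 3 → Fin 3 → EuclideanSpace ℝ (Fin 3) → ℝ := fun i j y =>
    fderiv ℝ (fun y => fderiv ℝ Ψ y (e i)) y (e j) with hH
  have hHc : ∀ i j, Continuous (H i j) := fun i j => continuous_fderiv_fderiv_apply hΨ2 _ _
  have hH0 : ∀ i j y, y ∉ tsupport Ψ → H i j y = 0 := fun i j y hy =>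
    fderiv_fderiv_apply_eq_zero_of_notMem_tsupport hy _ _
  have hH0' : ∀ i j y, y ∉ B → H i j y = 0 := fun i j y hy => hH0 i j y fun h => hy (hsupp h)
  have hHint0 : ∀ i j, ∫ y, H i j y = 0 := fun i j =>
    integral_fderiv_apply_eq_zero ((hΨ2.fderiv_right (m := 1) le_rfl).clm_apply contDiff_const)
      (hΨc.fderiv_apply (𝕜 := ℝ) (e i)) (e j)
  have hei : ∀ i, ‖e i‖ ≤ 1 := fun i => (e.orthonormal.1 i).le
  have hH3 : ∀ i j, eLpNorm (H i j) 3 volume ≤ C₃ * eLpNorm ψ 3 volume := fun i j =>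
    hC₃ hr hψ hψc (e i) (e j) (hei i) (hei j)
  obtain ⟨CH, hCH⟩ : ∃ CH : ℝ, ∀ i j y, ‖H i j y‖ ≤ CH := by
    have hb : ∀ i j, ∃ c, ∀ y, ‖H i j y‖ ≤ c := fun i j =>
      (hHc i j).bounded_above_of_compact_support (HasCompactSupport.intro hΨc (hH0 i j))
    choose c hc using hb
    refine ⟨∑ i, ∑ j, |c i j|, fun i j y => (hc i j y).trans ?_⟩
    calc c i j ≤ |c i j| := le_abs_self _
      _ ≤ ∑ j', |c i j'| := Finset.single_le_sum (f := fun j' => |c i j'|)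
          (fun _ _ => abs_nonneg _) (Finset.mem_univ j)
      _ ≤ ∑ i', ∑ j', |c i' j'| := Finset.single_le_sum (f := fun i' => ∑ j', |c i' j'|)
          (fun _ _ => Finset.sum_nonneg fun _ _ => abs_nonneg _) (Finset.mem_univ i)
  -- the components
  set comp : Fin 3 → EuclideanSpace ℝ (Fin 3) → ℝ := fun i y => ⟪w y, e i⟫ with hcomp
  have hHess : ∀ y, fderiv ℝ (fderiv ℝ Ψ) y (w y) (w y) =
      ∑ i, ∑ j, (comp i y * comp j y) * H i j y := fun y =>
    fderiv_fderiv_apply_apply_eq_sum hΨ2 _ _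
  -- integrability of each term `wᵢ wⱼ Hᵢⱼ` (dominated by `CH ‖w‖² 𝟙_B`)
  have hcm : ∀ i, AEStronglyMeasurable (comp i) ν := fun i => hwm.inner aestronglyMeasurable_const
  have hcomp_le : ∀ i y, ‖comp i y‖ ≤ ‖w y‖ := fun i y => by
    refine (norm_inner_le_norm _ _).trans ?_
    rw [e.orthonormal.1 i, mul_one]
  have hterm : ∀ i j, Integrable (fun y => (comp i y * comp j y) * H i j y) volume := by
    intro i j
    have hmeas : AEStronglyMeasurable (fun y => (comp i y * comp j y) * H i j y) volume := by
      have h1 : AEStronglyMeasurable (fun y => (comp i y * comp j y) * H i j y) ν :=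
        ((hcm i).mul (hcm j)).mul (hHc i j).aestronglyMeasurable
      have h2 : ∀ y, y ∉ B → (comp i y * comp j y) * H i j y = 0 := fun y hy => by
        rw [hH0' i j y hy, mul_zero]
      rw [← indicator_eq_self.2 (show support (fun y => (comp i y * comp j y) * H i j y) ⊆ B from
        fun y hy => by_contra fun hyB => hy (h2 y hyB))]
      exact (aestronglyMeasurable_indicator_iff measurableSet_ball).2 h1
    refine Integrable.mono' (g := fun y => CH * B.indicator (fun y => ‖w y‖ ^ 2) y) ?_ hmeas
      (Eventually.of_forall fun y => ?_)
    · exact ((integrable_indicator_iff measurableSet_ball).2 hw2int).const_mul CH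
    · by_cases hy : y ∈ B
      · rw [indicator_of_mem hy, norm_mul, norm_mul]
        calc ‖comp i y‖ * ‖comp j y‖ * ‖H i j y‖ ≤ ‖w y‖ * ‖w y‖ * CH :=
              mul_le_mul (mul_le_mul (hcomp_le i y) (hcomp_le j y) (norm_nonneg _)
                (norm_nonneg _)) (hCH i j y) (norm_nonneg _)
                (mul_nonneg (norm_nonneg _) (norm_nonneg _))
          _ = CH * ‖w y‖ ^ 2 := by ring
      · rw [hH0' i j y hy, mul_zero, norm_zero, indicator_of_notMem hy, mul_zero]
  -- ### Step 1: expand and subtract the means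
  -- the polarised squares and their means
  set fp : Fin 3 → Fin 3 → EuclideanSpace ℝ (Fin 3) → ℝ := fun i j y =>
    innerSL ℝ (e i + e j) (w y) with hfp
  set fm : Fin 3 → Fin 3 → EuclideanSpace ℝ (Fin 3) → ℝ := fun i j y =>
    innerSL ℝ (e i - e j) (w y) with hfm
  set cp : Fin 3 → Fin 3 → ℝ := fun i j => ⨍ z in B, (fp i j z) ^ 2 with hcp
  set cm : Fin 3 → Fin 3 → ℝ := fun i j => ⨍ z in B, (fm i j z) ^ 2 with hcm'
  set c : Fin 3 → Fin 3 → ℝ := fun i j => (1 / 4 : ℝ) * (cp i j - cm i j) with hc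
  have hpol : ∀ i j y, comp i y * comp j y = (1 / 4 : ℝ) * ((fp i j y) ^ 2 - (fm i j y) ^ 2) := by
    intro i j y
    simp only [hcomp, hfp, hfm, innerSL_apply_apply, inner_add_left, inner_sub_left,
      real_inner_comm (w y)]
    ring
  have hpol' : ∀ i j y, comp i y * comp j y - c i j =
      (1 / 4 : ℝ) * (((fp i j y) ^ 2 - cp i j) - ((fm i j y) ^ 2 - cm i j)) := by
    intro i j y; rw [hpol, hc]; ring
  -- `∫ wᵢwⱼ Hᵢⱼ = ∫_B (wᵢwⱼ - cᵢⱼ) Hᵢⱼ`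
  have hsub : ∀ i j, ∫ y, (comp i y * comp j y) * H i j y =
      ∫ y in B, (comp i y * comp j y - c i j) * H i j y := by
    intro i j
    have hHi : Integrable (H i j) volume :=
      (hHc i j).integrable_of_hasCompactSupport (HasCompactSupport.intro hΨc (hH0 i j))
    have e1 : ∫ y, (comp i y * comp j y) * H i j y = ∫ y in B, (comp i y * comp j y) * H i j y :=
      (setIntegral_eq_integral_of_forall_compl_eq_zero fun y hy => by
        rw [hH0' i j y hy, mul_zero]).symm
    have e2 : ∫ y in B, H i j y = 0 := by
      rw [setIntegral_eq_integral_of_forall_compl_eq_zero fun y hy => hH0' i j y hy, hHint0]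
    have e3 : ∫ y in B, (comp i y * comp j y - c i j) * H i j y =
        (∫ y in B, (comp i y * comp j y) * H i j y) - c i j * ∫ y in B, H i j y := by
      simp_rw [sub_mul]
      rw [integral_sub (hterm i j).integrableOn (hHi.integrableOn.const_mul _), integral_const_mul]
    rw [e1, e3, e2, mul_zero, sub_zero]
  -- ### Step 2: the `L^{3/2}` bound for `wᵢwⱼ - cᵢⱼ` and Hölder
  have h32ne : ((3 / 2 : ℝ≥0) : ℝ≥0∞) ≠ 0 := by norm_num
  have h32top : ((3 / 2 : ℝ≥0) : ℝ≥0∞) ≠ ∞ := ENNReal.coe_ne_top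
  have h32 : ((3 / 2 : ℝ≥0) : ℝ≥0∞).toReal = 3 / 2 := by norm_num
  have hnorm_add : ∀ i j, ‖e i + e j‖ ≤ 2 := fun i j =>
    (norm_add_le _ _).trans (by linarith [hei i, hei j])
  have hnorm_sub : ∀ i j, ‖e i - e j‖ ≤ 2 := fun i j =>
    (norm_sub_le _ _).trans (by linarith [hei i, hei j])
  -- `‖f² - ⨍ f²‖_{3/2} ≤ CP · 2 · (2 A^{1/2}) (2 EE^{1/2})` for `f = fp, fm`
  have hPS : ∀ a : EuclideanSpace ℝ (Fin 3), ‖a‖ ≤ 2 →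
      eLpNorm (fun y => (innerSL ℝ a (w y)) ^ 2 - ⨍ z in B, (innerSL ℝ a (w z)) ^ 2)
        ((3 / 2 : ℝ≥0) : ℝ≥0∞) ν ≤ CP * (8 * A ^ (1 / 2 : ℝ) * EE ^ (1 / 2 : ℝ)) := by
    intro a ha2
    refine (eLpNorm_inner_sq_sub_average_le hCP hρ hw hwL2 hGL2 a).trans ?_
    have ha' : ENNReal.ofReal ‖a‖ ≤ 2 :=
      (ENNReal.ofReal_le_ofReal ha2).trans_eq (ENNReal.ofReal_ofNat 2)
    rw [hL2]
    calc (CP : ℝ≥0∞) * (2 * (ENNReal.ofReal ‖a‖ * A ^ (1 / 2 : ℝ)) *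
          (ENNReal.ofReal ‖a‖ * eLpNorm Gw 2 ν))
        ≤ CP * (2 * (2 * A ^ (1 / 2 : ℝ)) * (2 * EE ^ (1 / 2 : ℝ))) := by gcongr
      _ = CP * (8 * A ^ (1 / 2 : ℝ) * EE ^ (1 / 2 : ℝ)) := by ring
  have hdiff : ∀ i j, eLpNorm (fun y => comp i y * comp j y - c i j) ((3 / 2 : ℝ≥0) : ℝ≥0∞) ν ≤
      4 * CP * A ^ (1 / 2 : ℝ) * EE ^ (1 / 2 : ℝ) := by
    intro i j
    set Fp : EuclideanSpace ℝ (Fin 3) → ℝ := fun y => (fp i j y) ^ 2 - cp i j with hFp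
    set Fm : EuclideanSpace ℝ (Fin 3) → ℝ := fun y => (fm i j y) ^ 2 - cm i j with hFm
    have hfpm : AEStronglyMeasurable (fp i j) ν :=
      (innerSL ℝ (e i + e j)).continuous.comp_aestronglyMeasurable hwm
    have hfmm : AEStronglyMeasurable (fm i j) ν :=
      (innerSL ℝ (e i - e j)).continuous.comp_aestronglyMeasurable hwm
    have hFpm : AEStronglyMeasurable Fp ν := (hfpm.pow 2).sub aestronglyMeasurable_const
    have hFmm : AEStronglyMeasurable Fm ν := (hfmm.pow 2).sub aestronglyMeasurable_const
    have hfun : (fun y => comp i y * comp j y - c i j) = (1 / 4 : ℝ) • (Fp - Fm) := by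
      funext y; rw [hpol']; rfl
    have hp : eLpNorm Fp ((3 / 2 : ℝ≥0) : ℝ≥0∞) ν ≤ CP * (8 * A ^ (1 / 2 : ℝ) * EE ^ (1 / 2 : ℝ)) :=
      hPS _ (hnorm_add i j)
    have hm : eLpNorm Fm ((3 / 2 : ℝ≥0) : ℝ≥0∞) ν ≤ CP * (8 * A ^ (1 / 2 : ℝ) * EE ^ (1 / 2 : ℝ)) :=
      hPS _ (hnorm_sub i j)
    rw [hfun, eLpNorm_const_smul, Real.enorm_eq_ofReal (by norm_num : (0 : ℝ) ≤ 1 / 4)]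
    calc ENNReal.ofReal (1 / 4 : ℝ) * eLpNorm (Fp - Fm) ((3 / 2 : ℝ≥0) : ℝ≥0∞) ν
        ≤ ENNReal.ofReal (1 / 4 : ℝ) * (eLpNorm Fp ((3 / 2 : ℝ≥0) : ℝ≥0∞) ν +
            eLpNorm Fm ((3 / 2 : ℝ≥0) : ℝ≥0∞) ν) := by
          gcongr
          exact eLpNorm_sub_le hFpm hFmm (by
            rw [← ENNReal.coe_one, ENNReal.coe_le_coe, ← NNReal.coe_le_coe]; push_cast; norm_num)
      _ ≤ ENNReal.ofReal (1 / 4 : ℝ) * (CP * (8 * A ^ (1 / 2 : ℝ) * EE ^ (1 / 2 : ℝ)) +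
            CP * (8 * A ^ (1 / 2 : ℝ) * EE ^ (1 / 2 : ℝ))) := by gcongr
      _ = 4 * CP * A ^ (1 / 2 : ℝ) * EE ^ (1 / 2 : ℝ) := by
          rw [ENNReal.ofReal_div_of_pos (by norm_num : (0 : ℝ) < 4), ENNReal.ofReal_one,
            ENNReal.ofReal_ofNat]
          have h4 : (4 : ℝ≥0∞) ≠ 0 := by norm_num
          have h4' : (4 : ℝ≥0∞) ≠ ∞ := by norm_num
          calc (1 / 4 : ℝ≥0∞) * (CP * (8 * A ^ (1 / 2 : ℝ) * EE ^ (1 / 2 : ℝ)) +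
                CP * (8 * A ^ (1 / 2 : ℝ) * EE ^ (1 / 2 : ℝ)))
              = 4⁻¹ * 4 * (4 * CP * A ^ (1 / 2 : ℝ) * EE ^ (1 / 2 : ℝ)) := by
                rw [one_div]; ring
            _ = 4 * CP * A ^ (1 / 2 : ℝ) * EE ^ (1 / 2 : ℝ) := by
                rw [ENNReal.inv_mul_cancel h4 h4', one_mul]
  -- Hölder `(3/2, 3)` for each pair
  have hpair : ∀ i j, ‖∫ y in B, (comp i y * comp j y - c i j) * H i j y‖ₑ ≤
      4 * CP * A ^ (1 / 2 : ℝ) * EE ^ (1 / 2 : ℝ) * (C₃ * eLpNorm ψ 3 volume) := by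
    intro i j
    have hpq : (3 / 2 : ℝ).HolderConjugate 3 :=
      Real.holderConjugate_iff.2 ⟨by norm_num, by norm_num⟩
    have hFm' : AEMeasurable (fun y => ‖comp i y * comp j y - c i j‖ₑ) ν :=
      ((((hcm i).mul (hcm j)).sub aestronglyMeasurable_const)).enorm
    have hHm' : AEMeasurable (fun y => ‖H i j y‖ₑ) ν := (hHc i j).measurable.enorm.aemeasurable
    have key := ENNReal.lintegral_mul_le_Lp_mul_Lq ν hpq hFm' hHm'
    simp only [Pi.mul_apply] at key
    have e1 : (∫⁻ y, ‖comp i y * comp j y - c i j‖ₑ ^ (3 / 2 : ℝ) ∂ν) ^ (1 / (3 / 2) : ℝ) =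
        eLpNorm (fun y => comp i y * comp j y - c i j) ((3 / 2 : ℝ≥0) : ℝ≥0∞) ν := by
      rw [eLpNorm_eq_lintegral_rpow_enorm_toReal h32ne h32top, h32]
    have e2 : (∫⁻ y, ‖H i j y‖ₑ ^ (3 : ℝ) ∂ν) ^ (1 / 3 : ℝ) ≤ eLpNorm (H i j) 3 volume := by
      rw [eLpNorm_eq_lintegral_rpow_enorm_toReal (by norm_num) (by norm_num : (3 : ℝ≥0∞) ≠ ∞),
        ENNReal.toReal_ofNat]
      gcongr
      exact Measure.restrict_le_self
    rw [e1] at key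
    calc ‖∫ y in B, (comp i y * comp j y - c i j) * H i j y‖ₑ
        ≤ ∫⁻ y in B, ‖(comp i y * comp j y - c i j) * H i j y‖ₑ :=
          enorm_integral_le_lintegral_enorm _
      _ = ∫⁻ y in B, ‖comp i y * comp j y - c i j‖ₑ * ‖H i j y‖ₑ := by
          simp_rw [enorm_mul]
      _ ≤ eLpNorm (fun y => comp i y * comp j y - c i j) ((3 / 2 : ℝ≥0) : ℝ≥0∞) ν *
            (∫⁻ y, ‖H i j y‖ₑ ^ (3 : ℝ) ∂ν) ^ (1 / 3 : ℝ) := key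
      _ ≤ (4 * CP * A ^ (1 / 2 : ℝ) * EE ^ (1 / 2 : ℝ)) * (C₃ * eLpNorm ψ 3 volume) :=
          mul_le_mul' (hdiff i j) (e2.trans (hH3 i j))
  -- ### Step 3: assemble
  calc ‖∫ y, fderiv ℝ (fderiv ℝ Ψ) y (w y) (w y)‖ₑ
      = ‖∑ i, ∑ j, ∫ y, (comp i y * comp j y) * H i j y‖ₑ := by
        simp_rw [hHess]
        rw [integral_finsetSum _ fun i _ => integrable_finsetSum _ fun j _ => hterm i j]
        congr 1
        exact Finset.sum_congr rfl fun i _ => integral_finsetSum _ fun j _ => hterm i j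
    _ ≤ ∑ i, ‖∑ j, ∫ y, (comp i y * comp j y) * H i j y‖ₑ := enorm_sum_le _ _
    _ ≤ ∑ i, ∑ j, ‖∫ y, (comp i y * comp j y) * H i j y‖ₑ :=
        Finset.sum_le_sum fun i _ => enorm_sum_le _ _
    _ = ∑ i, ∑ j, ‖∫ y in B, (comp i y * comp j y - c i j) * H i j y‖ₑ := by
        simp_rw [hsub]
    _ ≤ ∑ _i : Fin 3, ∑ _j : Fin 3,
          4 * CP * A ^ (1 / 2 : ℝ) * EE ^ (1 / 2 : ℝ) * (C₃ * eLpNorm ψ 3 volume) :=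
        Finset.sum_le_sum fun i _ => Finset.sum_le_sum fun j _ => hpair i j
    _ = ((9 * (4 * CP * C₃) : ℝ≥0) : ℝ≥0∞) * A ^ (1 / 2 : ℝ) * EE ^ (1 / 2 : ℝ) *
          eLpNorm ψ 3 volume := by
        simp only [Finset.sum_const, Finset.card_univ, Fintype.card_fin, nsmul_eq_mul,
          Nat.cast_ofNat]
        push_cast
        ring

end Literature.Analysis.FluidPDE
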